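import Summits.AnomalousDissipation.AnomalousDissipation.Theorems.MirrorStatisticsLoudTG.Negative.LoadBearing
import HarnessLib

/-!
# Tools for stub `stub_tubeLawSmoothK` (T2b) of line `regimes`
# (crux `MirrorEnsemble.MirrorStatisticsLoudTG`, stmt-AnomalousDissipation-17693): weighted estimates

Elementary integral calculus on `T³` feeding the deterministic KELVIN TUBE INEQUALITY
`stub_tubeLawSmoothK`: for a smooth exactly mirror-symmetric solenoidal field `v` and the tube current
`g` of the skeleton loop `C = ∂([0,½]² × {x₂ = 0})`, `|∫ ⟪Dg[v], v⟫| ≤ K A³ δ⁻¹ ∫_{N_δ} ∑ⱼ ‖∂ⱼv‖²`.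

* `tube_integral_inner_fderiv_eq_neg` — `∫ ⟪Dg[v], v⟫ = -∫ ⟪g, Dv[v]⟫` for `div v = 0` (transport
  identity applied to `⟪g, v⟫`); `tube_inner_fderiv_apply_eq_sum` — `⟪g, Dv[w]⟫ = ∑ₖ gₖ ∑ⱼ wⱼ ∂ⱼvₖ`.
* `tube_transversal_abstract`, `tube_longitudinal_abstract` — the two weighted one-dimensional
  estimates: `|∫ w u p| ≤ (M a / 2) (∫ ψ q² + ∫ ψ p²)` from `|w| ≤ M ψ`, Young's inequality and a
  weighted Poincaré inequality `∫ ψ u² ≤ a² ∫ ψ q²`; and `|∫ w u ∂ᵢu| ≤ (M/2) a² ∫ ψ (∂ᵢu)²` from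
  `|∂ᵢw| ≤ M ψ` (integration by parts of `½ ∂ᵢ(u²)` on the torus, no boundary term).
* `tube_poincare_slab`, `tube_poincare_two_slabs` — a slab inequality `∫_S φ u² ≤ a² ∫_S φ q²` (the
  form of the odd Poincaré stub T2a) as a whole-torus inequality with indicator weight;
  `tube_integral_weight_mul_le` — `∫ ψ G ≤ C ∫_N F` for `0 ≤ G ≤ F`, `ψ ≤ C 𝟙_N`;
  `tube_sq_partialDeriv_apply_le` — `(∂ᵢvₖ)² ≤ ∑ⱼ ‖∂ⱼv‖²`; measurability of slabs.
* `stub_tubeLawSmoothKTools` — the registered tools sub-stub (conjunction of the above).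

References: M. E. Brachet, D. I. Meiron, S. A. Orszag, B. G. Nickel, R. H. Morf, U. Frisch,
*Small-scale structure of the Taylor–Green vortex*, J. Fluid Mech. 130 (1983) 411–452, §2 (mirror
symmetries of the TG vortex, the impermeable box) [doi:10.1017/s0022112083001159]; L. C. Evans,
*Partial Differential Equations*, 2nd ed. (2010), App. C.2 Thm. 2 (integration by parts) and App. B.2
(Young's inequality) — folklore.
-/

-- every `Summit.AnomalousDissipation.AnomalousDissipation.…` name repeats the summit = problem segment (tree layout)
set_option linter.dupNamespace false

noncomputable section

namespace Summit.AnomalousDissipation.AnomalousDissipation.Theorems.MirrorEnsembleMirrorStatisticsLoudTG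

open MeasureTheory Filter Topology Set
open scoped ENNReal InnerProductSpace NNReal ContDiff
open Literature.Analysis.FunctionSpaces Literature.Analysis.FluidPDE

/-! ## Integration by parts against a solenoidal field -/

/-- `∫ ⟪Dg[v], v⟫ = -∫ ⟪g, Dv[v]⟫` for smooth `g`, `v` on `T³` with `div v = 0`: the transport
identity `∫ D⟪g, v⟫[v] = 0` and the Leibniz rule for `⟪g, v⟫`. [folklore] -/
theorem tube_integral_inner_fderiv_eq_neg {g v : UnitAddTorus (Fin 3) → EuclideanSpace ℝ (Fin 3)}
    (hg : Torus.IsSmooth g) (hv : Torus.IsSmooth v) (hdiv : Torus.IsDivFree v) :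
    ∫ x, ⟪Torus.fderiv g x (v x), v x⟫_ℝ = -∫ x, ⟪g x, Torus.fderiv v x (v x)⟫_ℝ := by
  have h0 := Torus.integral_fderiv_apply_eq_zero_of_isDivFree hv (hg.inner hv) hdiv
  have hpt : ∀ x, Torus.fderiv (fun y => ⟪g y, v y⟫_ℝ) x (v x) =
      ⟪g x, Torus.fderiv v x (v x)⟫_ℝ + ⟪Torus.fderiv g x (v x), v x⟫_ℝ := fun x =>
    Torus.fderiv_inner_apply (hg.isContDiff (by simp)) (hv.isContDiff (by simp)) x (v x)
  simp_rw [hpt] at h0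
  have h1 : Integrable (fun x => ⟪g x, Torus.fderiv v x (v x)⟫_ℝ) :=
    (hg.inner (hv.convect hv)).integrable
  have h2 : Integrable (fun x => ⟪Torus.fderiv g x (v x), v x⟫_ℝ) :=
    ((hv.convect hg).inner hv).integrable
  rw [integral_add h1 h2] at h0
  linarith

/-- `⟪g x, Dv(x)[w]⟫ = ∑ₖ gₖ(x) ∑ⱼ wⱼ ∂ⱼvₖ(x)` for a smooth field `v` on `T³`. [folklore] -/
theorem tube_inner_fderiv_apply_eq_sum {g v : UnitAddTorus (Fin 3) → EuclideanSpace ℝ (Fin 3)}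
    (hv : Torus.IsSmooth v) (x : UnitAddTorus (Fin 3)) (w : EuclideanSpace ℝ (Fin 3)) :
    ⟪g x, Torus.fderiv v x w⟫_ℝ = ∑ k, g x k * ∑ j, w j * Torus.partialDeriv j (fun y => v y k) x := by
  rw [Torus.fderiv_apply_eq_sum_partialDeriv (hv.isContDiff (by simp)), PiLp.inner_apply]
  refine Finset.sum_congr rfl fun k _ => ?_
  simp only [RCLike.inner_apply, conj_trivial, WithLp.ofLp_sum, WithLp.ofLp_smul, Finset.sum_apply,
    Pi.smul_apply, smul_eq_mul]
  rw [mul_comm]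
  congr 1
  refine Finset.sum_congr rfl fun j _ => ?_
  congr 1
  exact (Torus.partialDeriv_clm_comp hv (EuclideanSpace.proj k) j x).symm

/-! ## Weighted one-dimensional estimates (abstract form) -/

/-- A bounded measurable weight times a continuous function is integrable on `T³`. [folklore] -/
theorem tube_integrable_weight_mul {ψ F : UnitAddTorus (Fin 3) → ℝ} {C : ℝ} (hψm : Measurable ψ)
    (hψ0 : ∀ x, 0 ≤ ψ x) (hψC : ∀ x, ψ x ≤ C) (hF : Continuous F) :
    Integrable (fun x => ψ x * F x) :=
  hF.integrable_unitAddTorus.bdd_mul hψm.aestronglyMeasurable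
    (ae_of_all _ fun x => by rw [Real.norm_eq_abs, abs_of_nonneg (hψ0 x)]; exact hψC x)

/-- `∫ ψ G ≤ C ∫_N F` when `0 ≤ G ≤ F` are continuous, `0 ≤ ψ` and `ψ ≤ C 𝟙_N`. [folklore] -/
theorem tube_integral_weight_mul_le {ψ G F : UnitAddTorus (Fin 3) → ℝ} {N : Set (UnitAddTorus (Fin 3))}
    {C : ℝ} (hN : MeasurableSet N) (hF : Continuous F) (hG0 : ∀ x, 0 ≤ G x) (hGF : ∀ x, G x ≤ F x)
    (hψ0 : ∀ x, 0 ≤ ψ x) (hψN : ∀ x, ψ x ≤ C * N.indicator 1 x) :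
    ∫ x, ψ x * G x ≤ C * ∫ x in N, F x := by
  rw [← integral_indicator hN, ← integral_const_mul]
  refine integral_mono_of_nonneg (ae_of_all _ fun x => mul_nonneg (hψ0 x) (hG0 x))
    ((hF.integrable_unitAddTorus.indicator hN).const_mul C) (ae_of_all _ fun x => ?_)
  show ψ x * G x ≤ C * N.indicator F x
  by_cases hx : x ∈ N
  · have h1 : ψ x ≤ C := by simpa [hx] using hψN x
    rw [indicator_of_mem hx]
    calc ψ x * G x ≤ ψ x * F x := mul_le_mul_of_nonneg_left (hGF x) (hψ0 x)
      _ ≤ C * F x := mul_le_mul_of_nonneg_right h1 ((hG0 x).trans (hGF x))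
  · have h1 : ψ x = 0 := le_antisymm (by simpa [hx] using hψN x) (hψ0 x)
    simp [indicator_of_notMem hx, h1]

/-- **Transversal estimate** (Young + weighted Poincaré): if `|w| ≤ M ψ` and `∫ ψ u² ≤ a² ∫ ψ q²`,
then `|∫ w u p| ≤ (M a / 2) (∫ ψ q² + ∫ ψ p²)`. [folklore] -/
theorem tube_transversal_abstract {ψ u p q w : UnitAddTorus (Fin 3) → ℝ} {M a C : ℝ} (ha : 0 < a)
    (hM : 0 ≤ M) (hψm : Measurable ψ) (hψ0 : ∀ x, 0 ≤ ψ x) (hψC : ∀ x, ψ x ≤ C)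
    (hu : Continuous u) (hp : Continuous p) (hwψ : ∀ x, |w x| ≤ M * ψ x)
    (hP : ∫ x, ψ x * u x ^ 2 ≤ a ^ 2 * ∫ x, ψ x * q x ^ 2) :
    |∫ x, w x * (u x * p x)| ≤ M * a / 2 * ((∫ x, ψ x * q x ^ 2) + ∫ x, ψ x * p x ^ 2) := by
  have h2a : 0 < 2 * a := by positivity
  have hyoung : ∀ x, |u x| * |p x| ≤ (2 * a)⁻¹ * u x ^ 2 + a / 2 * p x ^ 2 := by
    intro x
    rw [← sq_abs (u x), ← sq_abs (p x), ← sub_nonneg]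
    have : (2 * a)⁻¹ * |u x| ^ 2 + a / 2 * |p x| ^ 2 - |u x| * |p x| =
        (2 * a)⁻¹ * (|u x| - a * |p x|) ^ 2 := by
      field_simp
      ring
    rw [this]
    positivity
  have hint : Integrable (fun x => ψ x * ((2 * a)⁻¹ * u x ^ 2 + a / 2 * p x ^ 2)) :=
    tube_integrable_weight_mul hψm hψ0 hψC (by fun_prop)
  have hi1 : Integrable (fun x => ψ x * u x ^ 2) := tube_integrable_weight_mul hψm hψ0 hψC (by fun_prop)
  have hi2 : Integrable (fun x => ψ x * p x ^ 2) := tube_integrable_weight_mul hψm hψ0 hψC (by fun_prop)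
  calc |∫ x, w x * (u x * p x)| ≤ ∫ x, |w x * (u x * p x)| := abs_integral_le_integral_abs
    _ ≤ ∫ x, M * (ψ x * ((2 * a)⁻¹ * u x ^ 2 + a / 2 * p x ^ 2)) := by
        refine integral_mono_of_nonneg (ae_of_all _ fun x => abs_nonneg _) (hint.const_mul M)
          (ae_of_all _ fun x => ?_)
        show |w x * (u x * p x)| ≤ M * (ψ x * ((2 * a)⁻¹ * u x ^ 2 + a / 2 * p x ^ 2))
        rw [abs_mul, abs_mul, ← mul_assoc M]
        exact mul_le_mul (hwψ x) (hyoung x) (mul_nonneg (abs_nonneg _) (abs_nonneg _))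
          (mul_nonneg hM (hψ0 x))
    _ = M * ((2 * a)⁻¹ * (∫ x, ψ x * u x ^ 2) + a / 2 * ∫ x, ψ x * p x ^ 2) := by
        have e : ∀ x, M * (ψ x * ((2 * a)⁻¹ * u x ^ 2 + a / 2 * p x ^ 2)) =
            M * (2 * a)⁻¹ * (ψ x * u x ^ 2) + M * (a / 2) * (ψ x * p x ^ 2) := fun x => by ring
        simp_rw [e]
        rw [integral_add ((hi1.const_mul _)) (hi2.const_mul _), integral_const_mul, integral_const_mul]
        ring
    _ ≤ M * ((2 * a)⁻¹ * (a ^ 2 * ∫ x, ψ x * q x ^ 2) + a / 2 * ∫ x, ψ x * p x ^ 2) := by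
        gcongr
    _ = M * a / 2 * ((∫ x, ψ x * q x ^ 2) + ∫ x, ψ x * p x ^ 2) := by
        field_simp

/-- **Longitudinal estimate** (integration by parts of `½ ∂ᵢ(u²)` + weighted Poincaré): if `w`, `u`
are smooth, `|∂ᵢw| ≤ M ψ` and `∫ ψ u² ≤ a² ∫ ψ (∂ᵢu)²`, then `|∫ w u ∂ᵢu| ≤ (M/2) a² ∫ ψ (∂ᵢu)²`.
[folklore] -/
theorem tube_longitudinal_abstract {ψ w u : UnitAddTorus (Fin 3) → ℝ} (i : Fin 3) {M a C : ℝ}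
    (hM : 0 ≤ M) (hψm : Measurable ψ) (hψ0 : ∀ x, 0 ≤ ψ x) (hψC : ∀ x, ψ x ≤ C)
    (hw : Torus.IsSmooth w) (hu : Torus.IsSmooth u)
    (hdw : ∀ x, |Torus.partialDeriv i w x| ≤ M * ψ x)
    (hP : ∫ x, ψ x * u x ^ 2 ≤ a ^ 2 * ∫ x, ψ x * Torus.partialDeriv i u x ^ 2) :
    |∫ x, w x * (u x * Torus.partialDeriv i u x)| ≤
      M / 2 * a ^ 2 * ∫ x, ψ x * Torus.partialDeriv i u x ^ 2 := by
  have hw1 : Torus.IsContDiff 1 w := hw.isContDiff (by simp)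
  have hu1 : Torus.IsContDiff 1 u := hu.isContDiff (by simp)
  have huu : Torus.IsSmooth (fun y => u y * u y) := ContDiff.mul hu hu
  have hwuu : Torus.IsSmooth (fun y => w y * (u y * u y)) := ContDiff.mul hw huu
  have hprod : ∀ x, Torus.partialDeriv i (fun y => w y * (u y * u y)) x =
      2 * (w x * (u x * Torus.partialDeriv i u x)) + Torus.partialDeriv i w x * (u x * u x) := by
    intro x
    rw [Torus.partialDeriv_mul hw1 (huu.isContDiff (by simp)), Torus.partialDeriv_mul hu1 hu1]
    ring
  have h0 : ∫ x, Torus.partialDeriv i (fun y => w y * (u y * u y)) x = 0 :=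
    Torus.integral_partialDeriv_eq_zero_holds hwuu i
  have hc1 : Continuous fun x => w x * (u x * Torus.partialDeriv i u x) :=
    hw.continuous.mul (hu.continuous.mul (hu.partialDeriv i).continuous)
  have hc2 : Continuous fun x => Torus.partialDeriv i w x * (u x * u x) :=
    (hw.partialDeriv i).continuous.mul (hu.continuous.mul hu.continuous)
  simp_rw [hprod] at h0
  rw [integral_add (hc1.integrable_unitAddTorus.const_mul 2) hc2.integrable_unitAddTorus,
    integral_const_mul] at h0
  have hI : ∫ x, w x * (u x * Torus.partialDeriv i u x) =
      -(1 / 2) * ∫ x, Torus.partialDeriv i w x * (u x * u x) := by linarith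
  have hi1 : Integrable (fun x => ψ x * u x ^ 2) :=
    tube_integrable_weight_mul hψm hψ0 hψC (hu.continuous.pow 2)
  rw [hI, abs_mul, abs_neg, abs_of_pos (by norm_num : (0 : ℝ) < 1 / 2)]
  have hhalf : (0 : ℝ) ≤ 1 / 2 := by norm_num
  calc 1 / 2 * |∫ x, Torus.partialDeriv i w x * (u x * u x)|
      ≤ 1 / 2 * ∫ x, |Torus.partialDeriv i w x * (u x * u x)| :=
        mul_le_mul_of_nonneg_left abs_integral_le_integral_abs hhalf
    _ ≤ 1 / 2 * ∫ x, M * (ψ x * u x ^ 2) := by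
        refine mul_le_mul_of_nonneg_left ?_ hhalf
        refine integral_mono_of_nonneg (ae_of_all _ fun x => abs_nonneg _) (hi1.const_mul M)
          (ae_of_all _ fun x => ?_)
        show |Torus.partialDeriv i w x * (u x * u x)| ≤ M * (ψ x * u x ^ 2)
        rw [abs_mul, show |u x * u x| = u x ^ 2 by rw [abs_mul_self, sq], ← mul_assoc]
        exact mul_le_mul_of_nonneg_right (hdw x) (sq_nonneg _)
    _ ≤ 1 / 2 * (M * (a ^ 2 * ∫ x, ψ x * Torus.partialDeriv i u x ^ 2)) := by
        rw [integral_const_mul]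
        exact mul_le_mul_of_nonneg_left (mul_le_mul_of_nonneg_left hP hM) hhalf
    _ = M / 2 * a ^ 2 * ∫ x, ψ x * Torus.partialDeriv i u x ^ 2 := by ring

/-! ## Indicator weights and the slab Poincaré inequality -/

/-- Indicators of sets are nonnegative. [folklore] -/
theorem tube_indicator_nonneg (S : Set (UnitAddTorus (Fin 3))) (x : UnitAddTorus (Fin 3)) :
    0 ≤ S.indicator (1 : UnitAddTorus (Fin 3) → ℝ) x :=
  indicator_nonneg (fun _ _ => zero_le_one) x

/-- Indicators of sets are at most one. [folklore] -/
theorem tube_indicator_le_one (S : Set (UnitAddTorus (Fin 3))) (x : UnitAddTorus (Fin 3)) :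
    S.indicator (1 : UnitAddTorus (Fin 3) → ℝ) x ≤ 1 :=
  indicator_apply_le' (fun _ => le_rfl) fun _ => zero_le_one

/-- Slabs `{‖xᵢ - c‖ ≤ a}` of `T³` are measurable. [folklore] -/
theorem tube_measurableSet_slab (i : Fin 3) (c : UnitAddCircle) (a : ℝ) :
    MeasurableSet {x : UnitAddTorus (Fin 3) | ‖x i - c‖ ≤ a} :=
  measurableSet_le ((continuous_apply i).sub continuous_const).norm.measurable measurable_const

/-- Slabs `{‖xᵢ‖ ≤ a}` of `T³` are measurable. [folklore] -/
theorem tube_measurableSet_slab_zero (i : Fin 3) (a : ℝ) :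
    MeasurableSet {x : UnitAddTorus (Fin 3) | ‖x i‖ ≤ a} :=
  measurableSet_le (continuous_apply i).norm.measurable measurable_const

/-- A set inequality `∫_S φ u² ≤ a² ∫_S φ q²` as a whole-torus inequality with weight `φ 𝟙_S`. [folklore] -/
theorem tube_poincare_slab {φ u q : UnitAddTorus (Fin 3) → ℝ} {S : Set (UnitAddTorus (Fin 3))} {a : ℝ}
    (hS : MeasurableSet S)
    (h : ∫ x in S, φ x * u x ^ 2 ≤ a ^ 2 * ∫ x in S, φ x * q x ^ 2) :
    ∫ x, φ x * S.indicator 1 x * u x ^ 2 ≤ a ^ 2 * ∫ x, φ x * S.indicator 1 x * q x ^ 2 := by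
  have e : ∀ f : UnitAddTorus (Fin 3) → ℝ,
      (fun x => φ x * S.indicator 1 x * f x) = S.indicator (fun x => φ x * f x) := by
    intro f
    funext x
    by_cases hx : x ∈ S <;> simp [hx]
  rw [e, e, integral_indicator hS, integral_indicator hS]
  exact h

/-- Two slab inequalities `∫_S φ u² ≤ a² ∫_S φ q²`, `∫_{S'} φ u² ≤ a² ∫_{S'} φ q²` add up to the
whole-torus inequality with weight `φ (𝟙_S + 𝟙_{S'})`. [folklore] -/
theorem tube_poincare_two_slabs {φ u q : UnitAddTorus (Fin 3) → ℝ} {S S' : Set (UnitAddTorus (Fin 3))}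
    {a C : ℝ} (hS : MeasurableSet S) (hS' : MeasurableSet S') (hφm : Measurable φ) (hφ0 : ∀ x, 0 ≤ φ x)
    (hφC : ∀ x, φ x ≤ C) (hu : Continuous u) (hq : Continuous q)
    (h : ∫ x in S, φ x * u x ^ 2 ≤ a ^ 2 * ∫ x in S, φ x * q x ^ 2)
    (h' : ∫ x in S', φ x * u x ^ 2 ≤ a ^ 2 * ∫ x in S', φ x * q x ^ 2) :
    ∫ x, φ x * (S.indicator 1 x + S'.indicator 1 x) * u x ^ 2 ≤
      a ^ 2 * ∫ x, φ x * (S.indicator 1 x + S'.indicator 1 x) * q x ^ 2 := by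
  have h1 := tube_poincare_slab hS h
  have h2 := tube_poincare_slab hS' h'
  have hint : ∀ T : Set (UnitAddTorus (Fin 3)), MeasurableSet T → ∀ f : UnitAddTorus (Fin 3) → ℝ,
      Continuous f → Integrable (fun x => φ x * T.indicator 1 x * f x) := fun T hT f hf =>
    tube_integrable_weight_mul (hφm.mul (measurable_one.indicator hT))
      (fun x => mul_nonneg (hφ0 x) (tube_indicator_nonneg T x))
      (fun x => mul_le_mul (hφC x) (tube_indicator_le_one T x) (tube_indicator_nonneg T x)
        ((hφ0 x).trans (hφC x))) hf
  have e : ∀ f : UnitAddTorus (Fin 3) → ℝ, (fun x => φ x * (S.indicator 1 x + S'.indicator 1 x) * f x) =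
      fun x => φ x * S.indicator 1 x * f x + φ x * S'.indicator 1 x * f x := by
    intro f
    funext x
    ring
  rw [e, e, integral_add (hint S hS (fun x => u x ^ 2) (hu.pow 2)) (hint S' hS' (fun x => u x ^ 2) (hu.pow 2)),
    integral_add (hint S hS (fun x => q x ^ 2) (hq.pow 2)) (hint S' hS' (fun x => q x ^ 2) (hq.pow 2))]
  linarith

/-! ## Components of the gradient -/

/-- Squares of components of partial derivatives are dominated by `∑ⱼ ‖∂ⱼv‖²`. [folklore] -/
theorem tube_sq_partialDeriv_apply_le {v : UnitAddTorus (Fin 3) → EuclideanSpace ℝ (Fin 3)}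
    (hv : Torus.IsSmooth v) (i k : Fin 3) (x : UnitAddTorus (Fin 3)) :
    Torus.partialDeriv i (fun y => v y k) x ^ 2 ≤ ∑ j, ‖Torus.partialDeriv j v x‖ ^ 2 := by
  have h : Torus.partialDeriv i (fun y => v y k) x = Torus.partialDeriv i v x k :=
    Torus.partialDeriv_clm_comp hv (EuclideanSpace.proj k) i x
  rw [h]
  calc Torus.partialDeriv i v x k ^ 2 ≤ ‖Torus.partialDeriv i v x‖ ^ 2 := by
        rw [← sq_abs, ← Real.norm_eq_abs]
        exact pow_le_pow_left₀ (norm_nonneg _) (PiLp.norm_apply_le (Torus.partialDeriv i v x) k) 2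
    _ ≤ ∑ j, ‖Torus.partialDeriv j v x‖ ^ 2 :=
        Finset.single_le_sum (f := fun j => ‖Torus.partialDeriv j v x‖ ^ 2) (fun j _ => sq_nonneg _)
          (Finset.mem_univ i)

/-! ## The registered tools sub-stub -/

/-- **Tools sub-stub `stub_tubeLawSmoothKTools`** of `stub_tubeLawSmoothK` (line `regimes`, crux
stmt-AnomalousDissipation-17693): the conjunction of the weighted-estimate lemmas of this file
(integration by parts against a solenoidal field, the transversal and longitudinal one-dimensional
estimates, the indicator repackaging of the slab Poincaré inequality, measurability of slabs and the
component bound `(∂ᵢvₖ)² ≤ ∑ⱼ ‖∂ⱼv‖²`). [folklore] -/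
theorem stub_tubeLawSmoothKTools :
    (∀ {g v : UnitAddTorus (Fin 3) → EuclideanSpace ℝ (Fin 3)} (hg : Torus.IsSmooth g) (hv :
      Torus.IsSmooth v) (hdiv : Torus.IsDivFree v), ∫ x, ⟪Torus.fderiv g x (v x), v x⟫_ℝ = -∫ x, ⟪g
      x, Torus.fderiv v x (v x)⟫_ℝ) ∧
    (∀ {g v : UnitAddTorus (Fin 3) → EuclideanSpace ℝ (Fin 3)} (hv : Torus.IsSmooth v) (x :
      UnitAddTorus (Fin 3)) (w : EuclideanSpace ℝ (Fin 3)), ⟪g x, Torus.fderiv v x w⟫_ℝ = ∑ k, g x k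
      * ∑ j, w j * Torus.partialDeriv j (fun y => v y k) x) ∧
    (∀ {ψ F : UnitAddTorus (Fin 3) → ℝ} {C : ℝ} (hψm : Measurable ψ) (hψ0 : ∀ x, 0 ≤ ψ x) (hψC : ∀
      x, ψ x ≤ C) (hF : Continuous F), Integrable (fun x => ψ x * F x)) ∧
    (∀ {ψ G F : UnitAddTorus (Fin 3) → ℝ} {N : Set (UnitAddTorus (Fin 3))} {C : ℝ} (hN :
      MeasurableSet N) (hF : Continuous F) (hG0 : ∀ x, 0 ≤ G x) (hGF : ∀ x, G x ≤ F x) (hψ0 : ∀ x, 0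
      ≤ ψ x) (hψN : ∀ x, ψ x ≤ C * N.indicator 1 x), ∫ x, ψ x * G x ≤ C * ∫ x in N, F x) ∧
    (∀ {ψ u p q w : UnitAddTorus (Fin 3) → ℝ} {M a C : ℝ} (ha : 0 < a) (hM : 0 ≤ M) (hψm :
      Measurable ψ) (hψ0 : ∀ x, 0 ≤ ψ x) (hψC : ∀ x, ψ x ≤ C) (hu : Continuous u) (hp : Continuous
      p) (hwψ : ∀ x, |w x| ≤ M * ψ x) (hP : ∫ x, ψ x * u x ^ 2 ≤ a ^ 2 * ∫ x, ψ x * q x ^ 2), |∫ x,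
      w x * (u x * p x)| ≤ M * a / 2 * ((∫ x, ψ x * q x ^ 2) + ∫ x, ψ x * p x ^ 2)) ∧
    (∀ {ψ w u : UnitAddTorus (Fin 3) → ℝ} (i : Fin 3) {M a C : ℝ} (hM : 0 ≤ M) (hψm : Measurable ψ)
      (hψ0 : ∀ x, 0 ≤ ψ x) (hψC : ∀ x, ψ x ≤ C) (hw : Torus.IsSmooth w) (hu : Torus.IsSmooth u) (hdw
      : ∀ x, |Torus.partialDeriv i w x| ≤ M * ψ x) (hP : ∫ x, ψ x * u x ^ 2 ≤ a ^ 2 * ∫ x, ψ x *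
      Torus.partialDeriv i u x ^ 2), |∫ x, w x * (u x * Torus.partialDeriv i u x)| ≤ M / 2 * a ^ 2 *
      ∫ x, ψ x * Torus.partialDeriv i u x ^ 2) ∧
    (∀ (S : Set (UnitAddTorus (Fin 3))) (x : UnitAddTorus (Fin 3)), 0 ≤ S.indicator (1 :
      UnitAddTorus (Fin 3) → ℝ) x) ∧
    (∀ (S : Set (UnitAddTorus (Fin 3))) (x : UnitAddTorus (Fin 3)), S.indicator (1 : UnitAddTorus
      (Fin 3) → ℝ) x ≤ 1) ∧
    (∀ (i : Fin 3) (c : UnitAddCircle) (a : ℝ), MeasurableSet {x : UnitAddTorus (Fin 3) | ‖x i - c‖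
      ≤ a}) ∧
    (∀ (i : Fin 3) (a : ℝ), MeasurableSet {x : UnitAddTorus (Fin 3) | ‖x i‖ ≤ a}) ∧
    (∀ {φ u q : UnitAddTorus (Fin 3) → ℝ} {S : Set (UnitAddTorus (Fin 3))} {a : ℝ} (hS :
      MeasurableSet S) (h : ∫ x in S, φ x * u x ^ 2 ≤ a ^ 2 * ∫ x in S, φ x * q x ^ 2), ∫ x, φ x *
      S.indicator 1 x * u x ^ 2 ≤ a ^ 2 * ∫ x, φ x * S.indicator 1 x * q x ^ 2) ∧
    (∀ {φ u q : UnitAddTorus (Fin 3) → ℝ} {S S' : Set (UnitAddTorus (Fin 3))} {a C : ℝ} (hS :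
      MeasurableSet S) (hS' : MeasurableSet S') (hφm : Measurable φ) (hφ0 : ∀ x, 0 ≤ φ x) (hφC : ∀
      x, φ x ≤ C) (hu : Continuous u) (hq : Continuous q) (h : ∫ x in S, φ x * u x ^ 2 ≤ a ^ 2 * ∫ x
      in S, φ x * q x ^ 2) (h' : ∫ x in S', φ x * u x ^ 2 ≤ a ^ 2 * ∫ x in S', φ x * q x ^ 2), ∫ x,
      φ x * (S.indicator 1 x + S'.indicator 1 x) * u x ^ 2 ≤ a ^ 2 * ∫ x, φ x * (S.indicator 1 x +
      S'.indicator 1 x) * q x ^ 2) ∧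
    (∀ {v : UnitAddTorus (Fin 3) → EuclideanSpace ℝ (Fin 3)} (hv : Torus.IsSmooth v) (i k : Fin 3)
      (x : UnitAddTorus (Fin 3)), Torus.partialDeriv i (fun y => v y k) x ^ 2 ≤ ∑ j,
      ‖Torus.partialDeriv j v x‖ ^ 2) :=
  ⟨tube_integral_inner_fderiv_eq_neg, tube_inner_fderiv_apply_eq_sum, tube_integrable_weight_mul,
    tube_integral_weight_mul_le, tube_transversal_abstract, tube_longitudinal_abstract,
    tube_indicator_nonneg, tube_indicator_le_one, tube_measurableSet_slab,
    tube_measurableSet_slab_zero, tube_poincare_slab, tube_poincare_two_slabs,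
    tube_sq_partialDeriv_apply_le⟩

end Summit.AnomalousDissipation.AnomalousDissipation.Theorems.MirrorEnsembleMirrorStatisticsLoudTG

end
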